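import Mathlib
import Literature.Combinatorics.Additive.TripleProductProperty

/-!
# Frame packings in `𝔽_p³`: two frame triples are STPP-compatible only as cyclic relabelings
# (structural form of the census clause K-F3, primes `p ≥ 5`)

Support file for route `MatrixMultiplication/GroupTheoreticSTPP`, crux `stmt-MatrixMultiplication-0597`,
cell `mm-stpp` (D-0046), CENSUS-PLAN §4 F3 / §7 S5.  Host `H = 𝔽_p³` (`Fin 3 → ZMod p`).  A *frame* is a
basis `(v₀, v₁, v₂)`; its triple is `T = (L(v₀)∖0, L(v₁)∖0, L(v₂)∖0)` (punctured lines), e.g. the AXES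
triple `(H₀∖0, H₁∖0, H₂∖0)` of Cohn–Kleinberg–Szegedy–Umans 2005, Prop. 5.2, whose pair
{axes, cyclic relabeling} is the printed two-triple STPP design.  The cell's engines found by exhaustion
that for every `3 ≤ n ≤ 32` the only frames `g` of `ℤ_n³` with `{T_axes, T_g}` STPP are the two cyclic
relabelings of the axes, and that `{axes, rot, rot²}` is not STPP (`k_max^{frame}(n) = 2`).  This file
PROVES the prime case for all `p ≥ 5`:

* `two_line_condition` — the three index patterns `(0,1,0)`, `(0,0,1)`, `(1,0,0)` of CKSU Def. 5.1 (ii)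
  each say: for all non-zero `λ, μ`, the vector `λvᵢ − μvⱼ` has a zero in one of two prescribed
  coordinates (generic extraction lemma `zero_or_zero_of_avoid`);
* `parallel_pair_of_two_line` — for `p ≥ 5` such a condition forces `vᵢ, vⱼ` to lie together in one of
  the two coordinate planes (choose `μ ∉ {0, a/a′, b/b′}`; this is where `p = 2, 3` — and composite `n` —
  escape the argument);
* `frame_pair_classification` — with `det(v) ≠ 0`: `{T_axes, T_v}` STPP ⇒ `(L(v₀), L(v₁), L(v₂))` is
  `(H₁, H₂, H₀)` or `(H₂, H₀, H₁)`;
* `not_addSimultaneousTPP_axes_rot_rot2` — the three cyclic relabelings together violate pattern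
  `(0,1,2)`; hence (informally, with `GL₃(𝔽_p)`-transitivity on frames) `k_max^{frame}(p) = 2` for every
  prime `p ≥ 5`: the CKSU Prop. 5.2 design is frame-optimal.

The sets are described by membership hypotheses (no new definitions): `x ∈ A 0 ↔ x 0 ≠ 0 ∧ x 1 = 0 ∧ x 2 = 0`
etc. for the axes, `x ∈ A 1 ↔ ∃ c ≠ 0, x = c • v₀` etc. for the frame.

WHAT THIS IS NOT: a statement about ONE template family (frame triples) in `𝔽_p³`, `p ≥ 5` prime; nothing
about arbitrary sets of size `p − 1`, composite moduli, or `ω`.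

## References
* H. Cohn, R. Kleinberg, B. Szegedy, C. Umans, FOCS 2005, Def. 5.1, Prop. 5.2 (the design in `Cyc_n³`).
-/

-- single-conjunct summit: the mandated namespace repeats `MatrixMultiplication`.
set_option linter.dupNamespace false

namespace Summit.MatrixMultiplication.MatrixMultiplication.Theorems

namespace FramePacking

open Finset Literature.Combinatorics.Additive

variable {p : ℕ} [Fact p.Prime]

/-! ### Arithmetic in `ZMod p` -/

/-- In `ZMod p`, `p ≥ 3`, for every `t` there is `s ≠ 0` with `s + t ≠ 0`. [folklore] -/
theorem exists_ne_zero_add_ne_zero (hp : 3 ≤ p) (t : ZMod p) : ∃ s : ZMod p, s ≠ 0 ∧ s + t ≠ 0 := by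
  have h2 : (2 : ZMod p) ≠ 0 := by
    intro h
    have h2 : ((2 : ℕ) : ZMod p) = 0 := by exact_mod_cast h
    rw [ZMod.natCast_eq_zero_iff] at h2
    have := Nat.le_of_dvd (by norm_num) h2
    omega
  by_cases h : (1 : ZMod p) + t = 0
  · refine ⟨2, h2, ?_⟩
    have ht : t = -1 := by linear_combination h
    rw [ht]; norm_num
  · exact ⟨1, one_ne_zero, h⟩

/-! ### The extraction lemma: avoiding `P_α + P_β + (P_γ − P_γ) + w` forces a zero coordinate of `w` -/

/-- **Generic two-line extraction.**  Let `α, β, γ` be the three coordinates of `𝔽_p³` (`p ≥ 3`) and let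
`P, Q, R` be the punctured axes in coordinates `α, β, γ` (membership hypotheses).  If a vector `w`
satisfies `x + y + (r − r') + w ≠ 0` for all `x ∈ P`, `y ∈ Q`, `r, r' ∈ R`, then `w α = 0` or `w β = 0`
(otherwise `x = −w_α e_α`, `y = −w_β e_β`, `r − r' = −w_γ e_γ` solve the equation). [folklore] -/
theorem zero_or_zero_of_avoid (hp : 3 ≤ p) {α β γ : Fin 3} (hαβ : α ≠ β) (hαγ : α ≠ γ) (hβγ : β ≠ γ)
    (hcov : ∀ i : Fin 3, i = α ∨ i = β ∨ i = γ)
    {P Q R : Finset (Fin 3 → ZMod p)}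
    (hP : ∀ x, x ∈ P ↔ x α ≠ 0 ∧ ∀ j, j ≠ α → x j = 0)
    (hQ : ∀ x, x ∈ Q ↔ x β ≠ 0 ∧ ∀ j, j ≠ β → x j = 0)
    (hR : ∀ x, x ∈ R ↔ x γ ≠ 0 ∧ ∀ j, j ≠ γ → x j = 0)
    {w : Fin 3 → ZMod p}
    (havoid : ∀ x ∈ P, ∀ y ∈ Q, ∀ r ∈ R, ∀ r' ∈ R, x + y + (r - r') + w ≠ 0) :
    w α = 0 ∨ w β = 0 := by
  by_contra hne
  rw [not_or] at hne
  obtain ⟨hα, hβ⟩ := hne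
  obtain ⟨s, hs0, hst⟩ := exists_ne_zero_add_ne_zero hp (w γ)
  have hx : Pi.single α (-(w α)) ∈ P := by
    rw [hP]; exact ⟨by simp [hα], fun j hj => by simp [Pi.single_eq_of_ne hj]⟩
  have hy : Pi.single β (-(w β)) ∈ Q := by
    rw [hQ]; exact ⟨by simp [hβ], fun j hj => by simp [Pi.single_eq_of_ne hj]⟩
  have hr : Pi.single γ s ∈ R := by
    rw [hR]; exact ⟨by simp [hs0], fun j hj => by simp [Pi.single_eq_of_ne hj]⟩
  have hr' : Pi.single γ (s + w γ) ∈ R := by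
    rw [hR]; exact ⟨by simp [hst], fun j hj => by simp [Pi.single_eq_of_ne hj]⟩
  refine havoid _ hx _ hy _ hr _ hr' ?_
  funext i
  simp only [Pi.add_apply, Pi.sub_apply, Pi.zero_apply]
  rcases hcov i with rfl | rfl | rfl
  · rw [Pi.single_eq_same, Pi.single_eq_of_ne hαβ, Pi.single_eq_of_ne hαγ, Pi.single_eq_of_ne hαγ]
    ring
  · rw [Pi.single_eq_same, Pi.single_eq_of_ne (Ne.symm hαβ), Pi.single_eq_of_ne hβγ,
      Pi.single_eq_of_ne hβγ]
    ring
  · rw [Pi.single_eq_same, Pi.single_eq_same, Pi.single_eq_of_ne (Ne.symm hαγ),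
      Pi.single_eq_of_ne (Ne.symm hβγ)]
    ring

/-! ### The counting step (`p ≥ 5`) -/

/-- If the `a`-alternative never holds, the `b`-alternative at `(λ, μ) = (1,1), (1,2)` forces `b = b' = 0`.
[folklore] -/
theorem eq_zero_of_forall_second {p : ℕ} [Fact p.Prime] (hp : 3 ≤ p) {a a' b b' : ZMod p}
    (h : ∀ lam mu : ZMod p, lam ≠ 0 → mu ≠ 0 → lam * a - mu * a' = 0 ∨ lam * b - mu * b' = 0)
    (hx : ∀ lam mu : ZMod p, lam ≠ 0 → mu ≠ 0 → lam * a - mu * a' ≠ 0) : b = 0 ∧ b' = 0 := by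
  have h2 : (2 : ZMod p) ≠ 0 := by
    intro h
    have h2 : ((2 : ℕ) : ZMod p) = 0 := by exact_mod_cast h
    rw [ZMod.natCast_eq_zero_iff] at h2
    have := Nat.le_of_dvd (by norm_num) h2
    omega
  have h11 : 1 * b - 1 * b' = 0 := (h 1 1 one_ne_zero one_ne_zero).resolve_left (hx 1 1 one_ne_zero one_ne_zero)
  have h12 : 1 * b - 2 * b' = 0 := (h 1 2 one_ne_zero h2).resolve_left (hx 1 2 one_ne_zero h2)
  constructor
  · linear_combination 2 * h11 - h12
  · linear_combination h11 - h12

/-- **Two lines with a two-coordinate alternative are jointly planar** (`p ≥ 5`): if for all non-zero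
`λ, μ ∈ 𝔽_p` one has `λa − μa' = 0` or `λb − μb' = 0`, then `a = a' = 0` or `b = b' = 0`.  (If all four are
non-zero pick `λ = 1`, `μ ∉ {0, a/a', b/b'}` — possible as `p ≥ 4`; if exactly one of `a, a'` vanishes the
first alternative never holds and `(λ,μ) = (1,1), (1,2)` in the second give `b = b' = 0`; symmetrically.)
[folklore] -/
theorem parallel_pair_of_two_line (hp : 5 ≤ p) {a a' b b' : ZMod p}
    (h : ∀ lam mu : ZMod p, lam ≠ 0 → mu ≠ 0 → lam * a - mu * a' = 0 ∨ lam * b - mu * b' = 0) :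
    (a = 0 ∧ a' = 0) ∨ (b = 0 ∧ b' = 0) := by
  have hp3 : 3 ≤ p := by omega
  by_cases ha : a = 0 ∧ a' = 0
  · exact Or.inl ha
  by_cases hb : b = 0 ∧ b' = 0
  · exact Or.inr hb
  exfalso
  have h' : ∀ lam mu : ZMod p, lam ≠ 0 → mu ≠ 0 → lam * b - mu * b' = 0 ∨ lam * a - mu * a' = 0 :=
    fun lam mu hl hm => (h lam mu hl hm).symm
  by_cases ha0 : a = 0
  · have ha' : a' ≠ 0 := fun h0 => ha ⟨ha0, h0⟩
    refine hb (eq_zero_of_forall_second hp3 h fun lam mu _ hm => ?_)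
    rw [ha0, mul_zero, zero_sub, neg_ne_zero]; exact mul_ne_zero hm ha'
  by_cases ha'0 : a' = 0
  · refine hb (eq_zero_of_forall_second hp3 h fun lam mu hl _ => ?_)
    rw [ha'0, mul_zero, sub_zero]; exact mul_ne_zero hl ha0
  by_cases hb0 : b = 0
  · have hb' : b' ≠ 0 := fun h0 => hb ⟨hb0, h0⟩
    refine ha (eq_zero_of_forall_second hp3 h' fun lam mu _ hm => ?_)
    rw [hb0, mul_zero, zero_sub, neg_ne_zero]; exact mul_ne_zero hm hb'
  by_cases hb'0 : b' = 0
  · refine ha (eq_zero_of_forall_second hp3 h' fun lam mu hl _ => ?_)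
    rw [hb'0, mul_zero, sub_zero]; exact mul_ne_zero hl hb0
  -- all four non-zero: choose `μ ∉ {0, a/a', b/b'}`
  set S : Finset (ZMod p) := {0, a / a', b / b'} with hS
  have hcard : S.card < (Finset.univ : Finset (ZMod p)).card := by
    rw [Finset.card_univ, ZMod.card]
    exact lt_of_le_of_lt Finset.card_le_three (by omega)
  obtain ⟨mu, -, hmu⟩ := Finset.exists_mem_notMem_of_card_lt_card hcard
  rw [hS] at hmu
  simp only [Finset.mem_insert, Finset.mem_singleton, not_or] at hmu
  obtain ⟨hmu0, hmua, hmub⟩ := hmu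
  rcases h 1 mu one_ne_zero hmu0 with h1 | h1
  · apply hmua
    rw [one_mul, sub_eq_zero] at h1
    rw [eq_div_iff ha'0, h1]
  · apply hmub
    rw [one_mul, sub_eq_zero] at h1
    rw [eq_div_iff hb'0, h1]

/-- Passing from vectors to coordinates: `(λ•u − μ•u') i = λ uᵢ − μ u'ᵢ`, so a two-coordinate alternative
for all non-zero `λ, μ` hands `parallel_pair_of_two_line` its hypothesis. [folklore] -/
theorem parallel_pair_of_vectors (hp : 5 ≤ p) {u u' : Fin 3 → ZMod p} {α β : Fin 3}
    (h : ∀ lam mu : ZMod p, lam ≠ 0 → mu ≠ 0 → (lam • u - mu • u') α = 0 ∨ (lam • u - mu • u') β = 0) :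
    (u α = 0 ∧ u' α = 0) ∨ (u β = 0 ∧ u' β = 0) := by
  refine parallel_pair_of_two_line hp fun lam mu hl hm => ?_
  have := h lam mu hl hm
  simpa only [Pi.sub_apply, Pi.smul_apply, smul_eq_mul] using this

/-! ### The classification -/

section Classification

variable {A B C : Fin 2 → Finset (Fin 3 → ZMod p)} {v₀ v₁ v₂ : Fin 3 → ZMod p}

/-- A punctured axis is closed under negation. [folklore] -/
theorem neg_mem_of_axis {P : Finset (Fin 3 → ZMod p)} {α : Fin 3}
    (hP : ∀ x, x ∈ P ↔ x α ≠ 0 ∧ ∀ j, j ≠ α → x j = 0) {x : Fin 3 → ZMod p} (hx : x ∈ P) : -x ∈ P := by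
  rw [hP] at hx ⊢
  exact ⟨by simpa using hx.1, fun j hj => by simp [hx.2 j hj]⟩

/-- **The three two-line conditions.**  If `{T_axes, T_v}` is STPP (additive CKSU Def. 5.1, index `0` the
axes, index `1` the frame `v`), then the index patterns `(0,1,0)`, `(0,0,1)`, `(1,0,0)` of clause (ii) give:
for all non-zero `λ, μ`, `λv₁ − μv₀` vanishes in coordinate `0` or `1`; `λv₂ − μv₁` in `1` or `2`;
`λv₀ − μv₂` in `0` or `2`. [cite: CohnKleinbergSzegedyUmans2005, Def. 5.1] -/
theorem two_line_conditions (hp : 3 ≤ p)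
    (hA0 : ∀ x, x ∈ A 0 ↔ x 0 ≠ 0 ∧ ∀ j, j ≠ 0 → x j = 0)
    (hB0 : ∀ x, x ∈ B 0 ↔ x 1 ≠ 0 ∧ ∀ j, j ≠ 1 → x j = 0)
    (hC0 : ∀ x, x ∈ C 0 ↔ x 2 ≠ 0 ∧ ∀ j, j ≠ 2 → x j = 0)
    (hA1 : ∀ x, x ∈ A 1 ↔ ∃ c : ZMod p, c ≠ 0 ∧ x = c • v₀)
    (hB1 : ∀ x, x ∈ B 1 ↔ ∃ c : ZMod p, c ≠ 0 ∧ x = c • v₁)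
    (hC1 : ∀ x, x ∈ C 1 ↔ ∃ c : ZMod p, c ≠ 0 ∧ x = c • v₂)
    (hS : AddSimultaneousTPP A B C) :
    (∀ lam mu : ZMod p, lam ≠ 0 → mu ≠ 0 → (lam • v₁ - mu • v₀) 0 = 0 ∨ (lam • v₁ - mu • v₀) 1 = 0) ∧
    (∀ lam mu : ZMod p, lam ≠ 0 → mu ≠ 0 → (lam • v₂ - mu • v₁) 1 = 0 ∨ (lam • v₂ - mu • v₁) 2 = 0) ∧
    (∀ lam mu : ZMod p, lam ≠ 0 → mu ≠ 0 → (lam • v₀ - mu • v₂) 0 = 0 ∨ (lam • v₀ - mu • v₂) 2 = 0) := by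
  have h01 : (0 : Fin 2) ≠ 1 := by decide
  refine ⟨fun lam mu hl hm => ?_, fun lam mu hl hm => ?_, fun lam mu hl hm => ?_⟩
  · -- pattern (0,1,0): a ∈ A0, a' = μv₀ ∈ A1, b = λv₁ ∈ B1, b' ∈ B0, c, c' ∈ C0
    refine zero_or_zero_of_avoid hp (α := 0) (β := 1) (γ := 2) (by decide) (by decide) (by decide)
      (by decide) hA0 hB0 hC0 fun x hx y hy r hr r' hr' heq => ?_
    have ha' : mu • v₀ ∈ A 1 := (hA1 _).2 ⟨mu, hm, rfl⟩
    have hb : lam • v₁ ∈ B 1 := (hB1 _).2 ⟨lam, hl, rfl⟩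
    have key := hS.2 0 1 0 x hx (mu • v₀) ha' (lam • v₁) hb (-y) (neg_mem_of_axis hB0 hy) r hr r' hr'
      (by rw [← heq]; abel)
    exact h01 key.1
  · -- pattern (0,0,1): a, a' ∈ A0, b ∈ B0, b' = μv₁ ∈ B1, c = λv₂ ∈ C1, c' ∈ C0
    refine zero_or_zero_of_avoid hp (α := 1) (β := 2) (γ := 0) (by decide) (by decide) (by decide)
      (by decide) hB0 hC0 hA0 fun x hx y hy r hr r' hr' heq => ?_
    have hb' : mu • v₁ ∈ B 1 := (hB1 _).2 ⟨mu, hm, rfl⟩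
    have hc : lam • v₂ ∈ C 1 := (hC1 _).2 ⟨lam, hl, rfl⟩
    have key := hS.2 0 0 1 r hr r' hr' x hx (mu • v₁) hb' (lam • v₂) hc (-y) (neg_mem_of_axis hC0 hy)
      (by rw [← heq]; abel)
    exact h01 key.2
  · -- pattern (1,0,0): a = λv₀ ∈ A1, a' ∈ A0, b, b' ∈ B0, c ∈ C0, c' = μv₂ ∈ C1
    refine zero_or_zero_of_avoid hp (α := 0) (β := 2) (γ := 1) (by decide) (by decide) (by decide)
      (by decide) hA0 hC0 hB0 fun x hx y hy r hr r' hr' heq => ?_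
    have ha : lam • v₀ ∈ A 1 := (hA1 _).2 ⟨lam, hl, rfl⟩
    have hc' : mu • v₂ ∈ C 1 := (hC1 _).2 ⟨mu, hm, rfl⟩
    have key := hS.2 1 0 0 (lam • v₀) ha (-x) (neg_mem_of_axis hA0 hx) r hr r' hr' y hy (mu • v₂) hc'
      (by rw [← heq]; abel)
    exact h01.symm key.1

/-- **Frame pairs are cyclic relabelings** (`p ≥ 5` prime).  Let `(v₀, v₁, v₂)` be a frame of `𝔽_p³`
(`det ≠ 0`) and suppose the two triples `T_axes = (H₀∖0, H₁∖0, H₂∖0)` (index `0`) and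
`T_v = (L(v₀)∖0, L(v₁)∖0, L(v₂)∖0)` (index `1`) satisfy the simultaneous triple product property.  Then
either `v₀ ∈ H₁, v₁ ∈ H₂, v₂ ∈ H₀` or `v₀ ∈ H₂, v₁ ∈ H₀, v₂ ∈ H₁` — the frame is one of the two cyclic
relabelings of the axes (as lines).  Structural form, for all primes `p ≥ 5`, of the census finding
`C_n = {rot, rot²}` (cell mm-stpp, engines A and B, `3 ≤ n ≤ 32`).
[cite: CohnKleinbergSzegedyUmans2005, Def. 5.1 and Prop. 5.2] -/
theorem frame_pair_classification (hp : 5 ≤ p)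
    (hA0 : ∀ x, x ∈ A 0 ↔ x 0 ≠ 0 ∧ ∀ j, j ≠ 0 → x j = 0)
    (hB0 : ∀ x, x ∈ B 0 ↔ x 1 ≠ 0 ∧ ∀ j, j ≠ 1 → x j = 0)
    (hC0 : ∀ x, x ∈ C 0 ↔ x 2 ≠ 0 ∧ ∀ j, j ≠ 2 → x j = 0)
    (hA1 : ∀ x, x ∈ A 1 ↔ ∃ c : ZMod p, c ≠ 0 ∧ x = c • v₀)
    (hB1 : ∀ x, x ∈ B 1 ↔ ∃ c : ZMod p, c ≠ 0 ∧ x = c • v₁)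
    (hC1 : ∀ x, x ∈ C 1 ↔ ∃ c : ZMod p, c ≠ 0 ∧ x = c • v₂)
    (hdet : Matrix.det (Matrix.of ![v₀, v₁, v₂]) ≠ 0)
    (hS : AddSimultaneousTPP A B C) :
    (v₀ 0 = 0 ∧ v₀ 2 = 0 ∧ v₁ 0 = 0 ∧ v₁ 1 = 0 ∧ v₂ 1 = 0 ∧ v₂ 2 = 0) ∨
    (v₀ 0 = 0 ∧ v₀ 1 = 0 ∧ v₁ 1 = 0 ∧ v₁ 2 = 0 ∧ v₂ 0 = 0 ∧ v₂ 2 = 0) := by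
  have hp3 : 3 ≤ p := by omega
  obtain ⟨c01, c12, c02⟩ := two_line_conditions hp3 hA0 hB0 hC0 hA1 hB1 hC1 hS
  have L01 := parallel_pair_of_vectors hp c01   -- (v₁ 0 = 0 ∧ v₀ 0 = 0) ∨ (v₁ 1 = 0 ∧ v₀ 1 = 0)
  have L12 := parallel_pair_of_vectors hp c12   -- (v₂ 1 = 0 ∧ v₁ 1 = 0) ∨ (v₂ 2 = 0 ∧ v₁ 2 = 0)
  have L02 := parallel_pair_of_vectors hp c02   -- (v₀ 0 = 0 ∧ v₂ 0 = 0) ∨ (v₀ 2 = 0 ∧ v₂ 2 = 0)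
  have hd : Matrix.det (Matrix.of ![v₀, v₁, v₂]) =
      v₀ 0 * v₁ 1 * v₂ 2 - v₀ 0 * v₁ 2 * v₂ 1 - v₀ 1 * v₁ 0 * v₂ 2 + v₀ 1 * v₁ 2 * v₂ 0 +
        v₀ 2 * v₁ 0 * v₂ 1 - v₀ 2 * v₁ 1 * v₂ 0 := by
    rw [Matrix.det_fin_three]; rfl
  rw [hd] at hdet
  rcases L01 with ⟨h10, h00⟩ | ⟨h11, h01⟩
  · -- `v₀, v₁ ∈ {x₀ = 0}`
    rcases L02 with ⟨-, h20⟩ | ⟨h02, h22⟩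
    · exfalso; apply hdet; rw [h00, h10, h20]; ring
    rcases L12 with ⟨h21, h11⟩ | ⟨-, h12⟩
    · exact Or.inl ⟨h00, h02, h10, h11, h21, h22⟩
    · exfalso; apply hdet; rw [h00, h10, h02, h12]; ring
  · -- `v₀, v₁ ∈ {x₁ = 0}`
    rcases L12 with ⟨h21, -⟩ | ⟨h22, h12⟩
    · exfalso; apply hdet; rw [h01, h11, h21]; ring
    rcases L02 with ⟨h00, h20⟩ | ⟨h02, -⟩
    · exact Or.inr ⟨h00, h01, h11, h12, h20, h22⟩
    · exfalso; apply hdet; rw [h01, h11, h02, h12]; ring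

end Classification

/-! ### Three frames: the cyclic relabelings together fail -/

/-- **`{axes, rot, rot²}` is not STPP.**  With `T₀ = (P₀, P₁, P₂)`, `T₁ = (P₁, P₂, P₀)`,
`T₂ = (P₂, P₀, P₁)` (`Pᵢ` the punctured axis `Hᵢ∖0`), the pattern `(i,j,k) = (0,1,2)` of CKSU
Def. 5.1 (ii) has the solution `a = b' = e₀`, `c = a' = e₁`, `b = c' = e₂` (only the six sets
`A₀, A₁, B₁, B₂, C₂, C₀` entering that pattern are constrained; `B₀, C₁, A₂` are arbitrary).  Together with
`frame_pair_classification` this gives `k_max^{frame}(p) = 2` for every prime `p ≥ 5` (any STPP family of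
frame triples containing the axes has at most the axes and ONE of its two cyclic relabelings).
[cite: CohnKleinbergSzegedyUmans2005, Def. 5.1] -/
theorem not_addSimultaneousTPP_axes_rot_rot2 {A B C : Fin 3 → Finset (Fin 3 → ZMod p)}
    (hA0 : ∀ x, x ∈ A 0 ↔ x 0 ≠ 0 ∧ ∀ j, j ≠ 0 → x j = 0)
    (hC0 : ∀ x, x ∈ C 0 ↔ x 2 ≠ 0 ∧ ∀ j, j ≠ 2 → x j = 0)
    (hA1 : ∀ x, x ∈ A 1 ↔ x 1 ≠ 0 ∧ ∀ j, j ≠ 1 → x j = 0)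
    (hB1 : ∀ x, x ∈ B 1 ↔ x 2 ≠ 0 ∧ ∀ j, j ≠ 2 → x j = 0)
    (hB2 : ∀ x, x ∈ B 2 ↔ x 0 ≠ 0 ∧ ∀ j, j ≠ 0 → x j = 0)
    (hC2 : ∀ x, x ∈ C 2 ↔ x 1 ≠ 0 ∧ ∀ j, j ≠ 1 → x j = 0) :
    ¬ AddSimultaneousTPP A B C := by
  intro hS
  have e_mem : ∀ (i : Fin 3) (P : Finset (Fin 3 → ZMod p)),
      (∀ x, x ∈ P ↔ x i ≠ 0 ∧ ∀ j, j ≠ i → x j = 0) → Pi.single i (1 : ZMod p) ∈ P := by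
    intro i P hP
    rw [hP]; exact ⟨by simp, fun j hj => by simp [Pi.single_eq_of_ne hj]⟩
  have key := hS.2 0 1 2 (Pi.single 0 1) (e_mem 0 _ hA0) (Pi.single 1 1) (e_mem 1 _ hA1)
    (Pi.single 2 1) (e_mem 2 _ hB1) (Pi.single 0 1) (e_mem 0 _ hB2) (Pi.single 1 1) (e_mem 1 _ hC2)
    (Pi.single 2 1) (e_mem 2 _ hC0) (by abel)
  exact absurd key.1 (by decide)

end FramePacking

end Summit.MatrixMultiplication.MatrixMultiplication.Theorems
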